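import Summits.NavierStokesRegularity.FluidComputer.PalasekTowerRegisterGlobalEnvelopeAt
import Summits.NavierStokesRegularity.NavierStokesRegularity.Theorems.PalasekTowerBreakdownLocalContinuationHolds
import Summits.NavierStokesRegularity.NavierStokesRegularity.Theorems.PalasekTowerBreakdownHeredityAtOneFloors
import Summits.NavierStokesRegularity.NavierStokesRegularity.Theorems.PalasekTowerBreakdownHeredityAtOneOrBreakdown
import Summits.NavierStokesRegularity.NavierStokesRegularity.Theses.PalasekTowerBreakdown

/-! # CANDIDATE skeleton v4 for the split child `HeredityAtOne` (item stmt-NavierStokesRegularity-19249) — NOT registered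

The k = 1 mirror of the v4 skeleton of `HeredityFromTwo` (item 19250, `Cruxes/HeredityFromTwo/Lines/birth.lean`, bytes of
ns-palasek-19250-p2 g2 adopted by director-ns g6, 2026-08-27T00:18Z), LICENSED for 19249 by planner g20's RULING
«PTB-ORBREAKDOWN» (2) «same licence for 19249 the moment the k = 1 mirror lands» — it landed: p474771
(`FluidComputer/PalasekTowerHeredityOrBreakdownAt.lean`) + p475295 (`Theorems/PalasekTowerBreakdownHeredityAtOneOrBreakdown.lean`).
Offered by the crux-strategist ns-palasek-19249-cstrat-1 (g3) as BYTES ONLY: both licensees (lead lineage ecbridge-1, stub-worker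
19249-p2) have lapsed without a successor, a strategist never registers over the lead's `Lines/birth.lean`, so adoption (crux write +
`ledger skeleton check … --crux stmt-NavierStokesRegularity-19249`) is the director's / tenure planner's call exactly as for 19250.

THE CUT (five stubs under the CURRENT item, no restatement): v3's upper stub `stub_apriori_ceiling_at_one : AprioriCeilingAt 1` is split
LOSSLESSLY (`Theorems.palasekTowerBreakdown_stub_apriori_ceiling_at_one_iff : AprioriCeilingAt 1 ↔ NoPrematureBreakdownAt 1 ∧
WindowCeilingAt 1`) into

* `stub_no_premature_breakdown_at_one : NoPrematureBreakdownAt 1` — «no registered level-1 design's flow dies inside window 1».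
  ITS FALSITY IS FEFFERMAN'S (C) (`Theorems.palasekTowerBreakdown_breakdownR3_of_prematureBreakdown_one`): a disprover's
  `stub_no_premature_breakdown_at_one_false` would prove the summit, so this stub is NOT a kill path of the route (RULING (3): a dying
  admissible design is a (C) EVENT); WORK ORDER (RULING (2)): LAST, never a seat's sole target;
* `stub_window_ceiling_at_one : WindowCeilingAt 1` — no SURVIVING registered level-1 flow overshoots `c₂ Y₂` on `[τ₁, τ₂]` (the genuine
  NS content of the upper half; the register-free universal form `SupGrowthBound (Y₂/Y₁ @ Θ₁ = 1176)` is presumptively FALSE — STRATEGY-CENSUS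
  R2 — so any proof goes through the registered `Stage 1 … 1` history);

and v3's three floor stubs are kept VERBATIM (`stub_speed_floor_at_one`, `stub_strain_floor_at_one`, `stub_core_floor_at_one`), as is the
DISCHARGED `stub_local_continuation_at_one` (tree theorem). `stub_apriori_ceiling_at_one` and `stub_readout_floors_one` are DERIVED (names kept
so the disprover's by-name `-- Targets` in `Cruxes/HeredityAtOne/Disproof.lean` still resolve). The composition `HeredityAtOne_of` is the
FIVE-argument form by the tree theorem `Theorems.palasekTowerBreakdown_heredityAtOne_of_noPrematureBreakdown_windowCeiling_floors3`
(p475295); v3's four-argument form survives as `HeredityAtOne_of_four`; `HeredityAtOne_skeleton` is the unique hypothesis-free line.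
WHAT THE RE-CUT DOES NOT DO (STRATEGY-CENSUS v4 §D5): it does not lighten the item — every stub still quantifies over registered level-1
stages (none exhibited: item 19179), LOSSLESS ≠ LIGHTER; it only makes the (C)-if-false conjunct a separate by-name target so that kill-path
bookkeeping counts window-ceiling / floor failures of SURVIVING designs only. WHAT THIS IS NOT: not NS; nothing decided; five `sorry`s =
five stubs. Cell `ns-blowup`. -/

namespace Summit.NavierStokesRegularity.FluidComputer.PalasekTowerClayBridge.BirthHeredityAtOne

open Summit.NavierStokesRegularity.NavierStokesRegularity

/-- DISCHARGED conjunct (v3 verbatim): every registered level-1 stage crosses the end `τ₁` of the forced era as a classical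
finite-energy solution — tree theorem, no named fact. -/
theorem stub_local_continuation_at_one : LocalContinuationAt 1 :=
  Theorems.palasekTowerBreakdown_localContinuationAt_holds 1

/-- candidate stub (upper half, clause 1/2): NO PREMATURE BREAKDOWN AT ONE — every pinned (Λ = 8, θ = 6/5) rigid quiet wide design
with a registered level-1 stage has its flow living classically with finite energy to `τ₂`. «(C) if false»:
`Theorems.palasekTowerBreakdown_breakdownR3_of_prematureBreakdown_one`. -/
theorem stub_no_premature_breakdown_at_one : NoPrematureBreakdownAt 1 := by
  sorry

/-- candidate stub (upper half, clause 2/2): the WINDOW CEILING AT ONE — every surviving registered level-1 flow (classical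
finite-energy solution of the design's system from the Clay datum on `[0, τ₂]`) stays `≤ c₂ Y₂` on `[τ₁, τ₂] × ℝ³`. -/
theorem stub_window_ceiling_at_one : WindowCeilingAt 1 := by
  sorry

/-- registered stub of v3, verbatim (lower half, conjunct 1/3): the SPEED floor at the first rung — speed `≥ c₁·Y₂` somewhere in
the ball at `τ₂`. -/
theorem stub_speed_floor_at_one : SpeedFloorAt 1 := by
  sorry

/-- registered stub of v3, verbatim (lower half, conjunct 2/3): the STRAIN floor at the first rung — a velocity gradient of operator
norm `≥ c₁·A₂` somewhere in the ball at `τ₂`. -/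
theorem stub_strain_floor_at_one : StrainFloorAt 1 := by
  sorry

/-- registered stub of v3, verbatim (lower half, conjunct 3/3): the CORE floor at the first rung — an `N₂`-core loop in the ball at
`τ₂` (Kelvin-critical, winding-blind). -/
theorem stub_core_floor_at_one : CoreFloorAt 1 := by
  sorry

/-- v3's upper stub, now DERIVED from the two clauses (`Theorems.palasekTowerBreakdown_stub_apriori_ceiling_at_one_iff`). -/
theorem stub_apriori_ceiling_at_one : AprioriCeilingAt 1 :=
  Theorems.palasekTowerBreakdown_stub_apriori_ceiling_at_one_iff.2
    ⟨stub_no_premature_breakdown_at_one, stub_window_ceiling_at_one⟩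

/-- v2's lower stub, DERIVED from the three floor stubs (as in v3; tree `readoutFloorsAt_of_floors`). -/
theorem stub_readout_floors_one : ReadoutFloorsAt 1 :=
  readoutFloorsAt_of_floors stub_speed_floor_at_one stub_strain_floor_at_one stub_core_floor_at_one

/-- The composition: the child crux BY NAME from the FIVE stubs (tree
`Theorems.palasekTowerBreakdown_heredityAtOne_of_noPrematureBreakdown_windowCeiling_floors3`, p475295). -/
theorem HeredityAtOne_of : NoPrematureBreakdownAt 1 → WindowCeilingAt 1 → SpeedFloorAt 1 → StrainFloorAt 1 → CoreFloorAt 1 →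
    Summit.NavierStokesRegularity.NavierStokesRegularity.Theses.PalasekTowerBreakdown.HeredityAtOne :=
  fun hN hW h₁ h₂ h₃ =>
    Theorems.palasekTowerBreakdown_heredityAtOne_of_noPrematureBreakdown_windowCeiling_floors3 hN hW h₁ h₂ h₃

/-- v3's four-argument composition (kept for readers of v3; `AprioriCeilingAt 1` is now derived). -/
theorem HeredityAtOne_of_four : AprioriCeilingAt 1 → SpeedFloorAt 1 → StrainFloorAt 1 → CoreFloorAt 1 →
    Summit.NavierStokesRegularity.NavierStokesRegularity.Theses.PalasekTowerBreakdown.HeredityAtOne :=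
  fun hA h₁ h₂ h₃ => Theorems.palasekTowerBreakdown_heredityAtOne_of_apriori_speed_strain_core hA h₁ h₂ h₃

/-- The hypothesis-free skeleton line: carries the five stubs' `sorry`s — decoration, not closure. -/
theorem HeredityAtOne_skeleton :
    Summit.NavierStokesRegularity.NavierStokesRegularity.Theses.PalasekTowerBreakdown.HeredityAtOne :=
  HeredityAtOne_of stub_no_premature_breakdown_at_one stub_window_ceiling_at_one stub_speed_floor_at_one
    stub_strain_floor_at_one stub_core_floor_at_one

end Summit.NavierStokesRegularity.FluidComputer.PalasekTowerClayBridge.BirthHeredityAtOne
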